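import Summits.Ventures.LatticeQCDFlow.Scoring.UNOnePlaquetteBesselDeterminant
import HarnessLib

/-!
# The `U(N)` one-plaquette law by `U(1)` flux sectors: `∫_{U(N)} (det U)^q e^{x Re tr U} dU = det[I_{|i−j+q|}(x)]_{i,j<N}` for every `N`, `q`

HONEST FRAMING: exact (Metropolis-corrected) sampling algorithms for lattice gauge theory;
figures of merit are autocorrelation/cost numbers at stated couplings and volumes; no
continuum-physics claim.

Venture `LatticeQCDFlow` (cell pub-lqcd), sub-topic `Scoring`; FANOUT row 5 (`s0-sun-a`), GEN-17.
NEW WORK of the cell (placement rule).  Sequel of `UNOnePlaquetteBesselDeterminant` (`q = 0`).  The continuous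
one-dimensional characters of `U(N)` are exactly the powers of the determinant (the tree's
`Literature/RepresentationTheory/CompactGroups/UnitaryGroupCharacters`); integrating the one-plaquette weight
against them gives the FOURIER COEFFICIENTS OF THE LAW OF `det U_p` under the `U(N)` one-plaquette law, again as
Toeplitz determinants of Bessel functions (Bars–Green 1979 (1.7) with a flux insertion):

* §1 a BOCHNER class-function Weyl formula for `U(n)` (real- and complex-valued continuous class functions), from
  the tree's `ℝ≥0∞` class-function form `WeylIntegration.lintegral_unitaryGroup_eq_angleIntegral` by positive and
  negative parts: `∫_{U(n)} F dU = ((2π)^N N!)⁻¹ ∫_{(−π,π]^N} F(diag e^{iθ}) Π_{j≺k}|e^{iθ_j} − e^{iθ_k}|² dθ`;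
* §2 the twisted weighted Vandermonde integral `∫ (Π_b e^{x cos θ_b} e^{iqθ_b}) |Δ|² dθ = (2π)^N N! det[I_{|i−j+q|}(x)]`
  (part 1's Andréief identity with the shifted Toeplitz matrix);
* §3 **`∫_{U(n)} (det U)^q e^{x Re tr U} dU = det[I_{|i−j+q|}(x)]_{i,j : Fin N}`** for every finite `n`, `q ∈ ℤ`,
  real `x` (`det(diag e^{iθ}) = e^{iΣθ}`; `det` is a class function); in particular these flux-sector integrals are
  REAL, and `q = 0` is part 2's partition function.

Summing §3 over `q ∈ ℤ` reproduces, term by term, the `SU(N)` series of `SUNOnePlaquetteBesselSeries`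
(`Σ_q det[I_{|q+i−j|}]`): the `SU(N)` one-plaquette integral is the sum of the `U(N)` flux sectors.  No `def`,
nothing cited as a fact, 0 sorry.
-/

noncomputable section

open Real MeasureTheory Finset Complex Equiv
open scoped ENNReal
open Literature.MathematicalPhysics.QuantumFieldTheory (haarProbability)
open Literature.MathematicalPhysics.QuantumLattice
open Literature.Analysis.FunctionSpaces
open Literature.RepresentationTheory.CompactGroups
open Literature.RepresentationTheory.CompactGroups.WeylIntegration
open Literature.LinearAlgebra.Matrix (diagonalTorus)

namespace Summit.Ventures.LatticeQCDFlow.Scoring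

variable {n : Type*} [Fintype n] [DecidableEq n]

/-! ### 1. The Bochner class-function Weyl formula for `U(n)` -/

/-- A continuous real function on `U(n)` is integrable for the Haar probability measure. -/
theorem integrable_haar_unitaryGroup_of_continuous {F : Matrix.unitaryGroup n ℂ → ℝ} (hF : Continuous F) :
    Integrable F (haarProbability (Matrix.unitaryGroup n ℂ)) := by
  obtain ⟨C, hC⟩ : ∃ C, ∀ u : Matrix.unitaryGroup n ℂ, ‖F u‖ ≤ C :=
    ⟨_, (BoundedContinuousFunction.mkOfCompact ⟨_, hF⟩).norm_coe_le_norm⟩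
  exact Integrable.mono' (integrable_const C) hF.aestronglyMeasurable (Filter.Eventually.of_forall hC)

/-- The real weighted integrand `F(diag e^{iθ}) Π|…|²` is integrable on the cube for continuous `F`. -/
theorem integrable_cube_classFun_mul_weight {F : Matrix.unitaryGroup n ℂ → ℝ} (hF : Continuous F) :
    Integrable (fun θ : n → ℝ => F ((torusPt θ : diagonalTorus n) : Matrix.unitaryGroup n ℂ) *
        ∏ p : OD n, ‖cexp (θ p.1.1 * I) - cexp (θ p.1.2 * I)‖ ^ 2)
      (Measure.pi fun _ : n => (volume : Measure ℝ).restrict (Set.Ioc (-π) π)) := by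
  obtain ⟨C, hC⟩ : ∃ C, ∀ u : Matrix.unitaryGroup n ℂ, ‖F u‖ ≤ C :=
    ⟨_, (BoundedContinuousFunction.mkOfCompact ⟨_, hF⟩).norm_coe_le_norm⟩
  have hc : Continuous fun θ : n → ℝ => F ((torusPt θ : diagonalTorus n) : Matrix.unitaryGroup n ℂ) :=
    hF.comp (continuous_subtype_val.comp continuous_torusPt)
  simp_rw [prod_OD_norm_sub_sq_eq_norm_vdm_sq]
  refine Integrable.mono' (integrable_const (C * (2 ^ Fintype.card (OD n)) ^ 2)) (hc.mul continuous_norm_vdm_sq).aestronglyMeasurable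
    (Filter.Eventually.of_forall fun θ => ?_)
  rw [norm_mul, Real.norm_of_nonneg (sq_nonneg _)]
  exact mul_le_mul (hC _) (norm_vdm_sq_le θ) (sq_nonneg _) ((norm_nonneg (F 1)).trans (hC 1))

/-- **THE CLASS-FUNCTION WEYL FORMULA FOR `U(n)`, BOCHNER FORM (real-valued)**: for a continuous real class
function `F` on `U(n)`, `∫_{U(n)} F dU = ((2π)^N N!)⁻¹ ∫_{(−π,π]^N} F(diag e^{iθ}) Π_{j≺k}|e^{iθ_j} − e^{iθ_k}|² dθ`
(from the tree's `ℝ≥0∞` form by positive and negative parts). -/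
theorem integral_haar_unitaryGroup_classFun {F : Matrix.unitaryGroup n ℂ → ℝ} (hF : Continuous F)
    (hcl : ∀ g u : Matrix.unitaryGroup n ℂ, F (g * u * g⁻¹) = F u) :
    ∫ u, F u ∂(haarProbability (Matrix.unitaryGroup n ℂ))
      = ((2 * π) ^ Fintype.card n * (Fintype.card n).factorial)⁻¹ *
        ∫ θ, F ((torusPt θ : diagonalTorus n) : Matrix.unitaryGroup n ℂ) *
            ∏ p : OD n, ‖cexp (θ p.1.1 * I) - cexp (θ p.1.2 * I)‖ ^ 2
          ∂(Measure.pi fun _ : n => (volume : Measure ℝ).restrict (Set.Ioc (-π) π)) := by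
  -- the `ℝ≥0∞` class-function formula for the positive and negative parts
  have key : ∀ G : Matrix.unitaryGroup n ℂ → ℝ, Continuous G → (∀ g u : Matrix.unitaryGroup n ℂ, G (g * u * g⁻¹) = G u) →
      (∫⁻ u, ENNReal.ofReal (G u) ∂(haarProbability (Matrix.unitaryGroup n ℂ))).toReal
        = ((2 * π) ^ Fintype.card n * (Fintype.card n).factorial)⁻¹ *
          (∫⁻ θ, ENNReal.ofReal (G ((torusPt θ : diagonalTorus n) : Matrix.unitaryGroup n ℂ) *
              ∏ p : OD n, ‖cexp (θ p.1.1 * I) - cexp (θ p.1.2 * I)‖ ^ 2)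
            ∂(Measure.pi fun _ : n => (volume : Measure ℝ).restrict (Set.Ioc (-π) π))).toReal := by
    intro G hG hGcl
    rw [lintegral_unitaryGroup_eq_angleIntegral (F := fun u => ENNReal.ofReal (G u))
      (ENNReal.measurable_ofReal.comp hG.measurable) (fun g u => by simp only [hGcl]), angleIntegral,
      show (volume : Measure (n → ℝ)).restrict (Set.pi Set.univ fun _ => Set.Ioc (-π) π) =
        Measure.pi fun _ : n => (volume : Measure ℝ).restrict (Set.Ioc (-π) π) from Measure.restrict_pi_pi _ _,
      ENNReal.toReal_mul, ENNReal.toReal_inv, ENNReal.toReal_mul, ENNReal.toReal_pow, ENNReal.toReal_ofReal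
        Real.two_pi_pos.le, ENNReal.toReal_natCast]
    congr 1
    congr 1
    refine lintegral_congr fun θ => ?_
    rw [ENNReal.ofReal_mul' (Finset.prod_nonneg fun p _ => sq_nonneg _)]
  have hw : ∀ θ : n → ℝ, 0 ≤ ∏ p : OD n, ‖cexp (θ p.1.1 * I) - cexp (θ p.1.2 * I)‖ ^ 2 := fun θ =>
    Finset.prod_nonneg fun p _ => sq_nonneg _
  rw [integral_eq_lintegral_pos_part_sub_lintegral_neg_part (integrable_haar_unitaryGroup_of_continuous hF),
    integral_eq_lintegral_pos_part_sub_lintegral_neg_part (integrable_cube_classFun_mul_weight hF),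
    key F hF hcl, key (fun u => -F u) hF.neg (fun g u => by rw [hcl]), ← mul_sub]
  congr 2
  refine congrArg ENNReal.toReal (lintegral_congr fun θ => ?_)
  rw [neg_mul]

/-- **The class-function Weyl formula for `U(n)`, Bochner form, complex-valued.** -/
theorem integral_haar_unitaryGroup_classFun_complex {F : Matrix.unitaryGroup n ℂ → ℂ} (hF : Continuous F)
    (hcl : ∀ g u : Matrix.unitaryGroup n ℂ, F (g * u * g⁻¹) = F u) :
    ∫ u, F u ∂(haarProbability (Matrix.unitaryGroup n ℂ))
      = (((2 * π) ^ Fintype.card n * (Fintype.card n).factorial)⁻¹ : ℝ) *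
        ∫ θ, F ((torusPt θ : diagonalTorus n) : Matrix.unitaryGroup n ℂ) *
            ((∏ p : OD n, ‖cexp (θ p.1.1 * I) - cexp (θ p.1.2 * I)‖ ^ 2 : ℝ) : ℂ)
          ∂(Measure.pi fun _ : n => (volume : Measure ℝ).restrict (Set.Ioc (-π) π)) := by
  have hre := integral_haar_unitaryGroup_classFun (F := fun u => (F u).re) (Complex.continuous_re.comp hF)
    (fun g u => by simp only [hcl])
  have him := integral_haar_unitaryGroup_classFun (F := fun u => (F u).im) (Complex.continuous_im.comp hF)
    (fun g u => by simp only [hcl])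
  have hint : Integrable F (haarProbability (Matrix.unitaryGroup n ℂ)) := by
    obtain ⟨C, hC⟩ : ∃ C, ∀ u : Matrix.unitaryGroup n ℂ, ‖F u‖ ≤ C :=
      ⟨_, (BoundedContinuousFunction.mkOfCompact ⟨_, hF⟩).norm_coe_le_norm⟩
    exact Integrable.mono' (integrable_const C) hF.aestronglyMeasurable (Filter.Eventually.of_forall hC)
  have hint2 : Integrable (fun θ : n → ℝ => F ((torusPt θ : diagonalTorus n) : Matrix.unitaryGroup n ℂ) *
      ((∏ p : OD n, ‖cexp (θ p.1.1 * I) - cexp (θ p.1.2 * I)‖ ^ 2 : ℝ) : ℂ))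
      (Measure.pi fun _ : n => (volume : Measure ℝ).restrict (Set.Ioc (-π) π)) := by
    obtain ⟨C, hC⟩ : ∃ C, ∀ u : Matrix.unitaryGroup n ℂ, ‖F u‖ ≤ C :=
      ⟨_, (BoundedContinuousFunction.mkOfCompact ⟨_, hF⟩).norm_coe_le_norm⟩
    have hc : Continuous fun θ : n → ℝ => F ((torusPt θ : diagonalTorus n) : Matrix.unitaryGroup n ℂ) :=
      hF.comp (continuous_subtype_val.comp continuous_torusPt)
    simp_rw [prod_OD_norm_sub_sq_eq_norm_vdm_sq]
    refine Integrable.mono' (integrable_const (C * (2 ^ Fintype.card (OD n)) ^ 2))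
      (hc.mul (Complex.continuous_ofReal.comp continuous_norm_vdm_sq)).aestronglyMeasurable
      (Filter.Eventually.of_forall fun θ => ?_)
    rw [norm_mul, Complex.norm_real, Real.norm_of_nonneg (sq_nonneg _)]
    exact mul_le_mul (hC _) (norm_vdm_sq_le θ) (sq_nonneg _) ((norm_nonneg (F 1)).trans (hC 1))
  apply Complex.ext
  · have h1 := integral_re hint
    have h2 := integral_re hint2
    simp only [RCLike.re_to_complex] at h1 h2
    rw [← h1, hre, Complex.re_ofReal_mul, ← h2]
    congr 1
    refine integral_congr_ae (Filter.Eventually.of_forall fun θ => ?_)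
    simp only [Complex.re_mul_ofReal]
  · have h1 := integral_im hint
    have h2 := integral_im hint2
    simp only [RCLike.im_to_complex] at h1 h2
    rw [← h1, him, Complex.im_ofReal_mul, ← h2]
    congr 1
    refine integral_congr_ae (Filter.Eventually.of_forall fun θ => ?_)
    simp only [Complex.im_mul_ofReal]

/-! ### 2. The twisted weighted Vandermonde integral -/

/-- Each term of the twisted Leibniz double expansion is integrable on the cube. -/
theorem integrable_cube_weighted_term_twist (x : ℝ) (q : ℤ) (σ τ : Perm n) :
    Integrable (fun θ : n → ℝ => ((Equiv.Perm.sign σ : ℤ) : ℂ) * ((Equiv.Perm.sign τ : ℤ) : ℂ) *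
        ∏ b, (cexp ((x : ℂ) * Real.cos (θ b)) * cexp ((charVec σ b - charVec τ b + q : ℤ) * θ b * I)))
      (Measure.pi fun _ : n => (volume : Measure ℝ).restrict (Set.Ioc (-π) π)) := by
  refine Integrable.const_mul ?_ _
  refine Integrable.mono' (integrable_const ((Real.exp |x|) ^ Fintype.card n)) ?_
    (Filter.Eventually.of_forall fun θ => ?_)
  · exact (continuous_finsetProd _ fun b _ => by fun_prop).aestronglyMeasurable
  · rw [norm_prod, ← Finset.card_univ, ← Finset.prod_const]
    refine Finset.prod_le_prod (fun b _ => norm_nonneg _) fun b _ => ?_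
    rw [norm_mul, show ((charVec σ b - charVec τ b + q : ℤ) : ℂ) * (θ b : ℂ) * I
        = (((charVec σ b - charVec τ b + q : ℤ) : ℝ) * θ b : ℝ) * I by push_cast; ring,
      Complex.norm_exp_ofReal_mul_I, mul_one, show (x : ℂ) * (Real.cos (θ b) : ℂ) = ((x * Real.cos (θ b) : ℝ) : ℂ) by
        push_cast; ring, Complex.norm_exp_ofReal, Real.exp_le_exp]
    calc x * Real.cos (θ b) ≤ |x * Real.cos (θ b)| := le_abs_self _
      _ = |x| * |Real.cos (θ b)| := abs_mul _ _
      _ ≤ |x| * 1 := mul_le_mul_of_nonneg_left (Real.abs_cos_le_one _) (abs_nonneg _)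
      _ = |x| := mul_one _

/-- **THE TWISTED WEIGHTED VANDERMONDE INTEGRAL**:
`∫_{(−π,π]^N} (Π_b e^{x cos θ_b} e^{iqθ_b}) |Δ(e^{iθ})|² dθ = (2π)^N · N! · det[I_{|i−j+q|}(x)]_{i,j}` (entries through `enum n`). -/
theorem integral_cube_prod_cexp_cos_twist_mul_norm_vdm_sq (x : ℝ) (q : ℤ) :
    ∫ θ, (∏ b, (cexp ((x : ℂ) * Real.cos (θ b)) * cexp ((q : ℂ) * θ b * I))) * ((‖vdm θ‖ ^ 2 : ℝ) : ℂ)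
        ∂(Measure.pi fun _ : n => (volume : Measure ℝ).restrict (Set.Ioc (-π) π))
      = (2 * π : ℂ) ^ Fintype.card n * (Fintype.card n).factorial *
          (Matrix.of fun i j : n =>
            (besselI (((enum n i : ℕ) : ℤ) - ((enum n j : ℕ) : ℤ) + q).natAbs x : ℂ)).det := by
  have hexp : ∀ θ : n → ℝ, (∏ b, (cexp ((x : ℂ) * Real.cos (θ b)) * cexp ((q : ℂ) * θ b * I))) *
      ((‖vdm θ‖ ^ 2 : ℝ) : ℂ)
      = ∑ σ : Perm n, ∑ τ : Perm n, ((Equiv.Perm.sign σ : ℤ) : ℂ) * ((Equiv.Perm.sign τ : ℤ) : ℂ) *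
          ∏ b, (cexp ((x : ℂ) * Real.cos (θ b)) * cexp ((charVec σ b - charVec τ b + q : ℤ) * θ b * I)) := by
    intro θ
    rw [norm_vdm_sq_eq_sum, Finset.mul_sum]
    refine Finset.sum_congr rfl fun σ _ => ?_
    rw [Finset.mul_sum]
    refine Finset.sum_congr rfl fun τ _ => ?_
    rw [mul_left_comm, ← Finset.prod_mul_distrib]
    congr 1
    refine Finset.prod_congr rfl fun b _ => ?_
    rw [mul_assoc, ← Complex.exp_add]
    congr 2
    push_cast
    ring
  simp_rw [hexp]
  rw [integral_finsetSum _ (fun σ _ => integrable_finsetSum _ fun τ _ => integrable_cube_weighted_term_twist x q σ τ)]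
  simp_rw [integral_finsetSum _ (fun τ _ => integrable_cube_weighted_term_twist x q _ τ), integral_const_mul]
  have hI : ∀ σ τ : Perm n,
      ∫ θ, ∏ b, (cexp ((x : ℂ) * Real.cos (θ b)) * cexp ((charVec σ b - charVec τ b + q : ℤ) * θ b * I))
        ∂(Measure.pi fun _ : n => (volume : Measure ℝ).restrict (Set.Ioc (-π) π))
      = (2 * π : ℂ) ^ Fintype.card n *
          ∏ b, (besselI (((enum n (σ.symm b) : ℕ) : ℤ) - ((enum n (τ.symm b) : ℕ) : ℤ) + q).natAbs x : ℂ) := by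
    intro σ τ
    rw [integral_fintype_prod_eq_prod (𝕜 := ℂ)
      (fun b (θ : ℝ) => cexp ((x : ℂ) * Real.cos θ) * cexp ((charVec σ b - charVec τ b + q : ℤ) * θ * I))]
    simp_rw [integral_Ioc_cexp_mul_cos_mul_cexp_int]
    rw [Finset.prod_mul_distrib, Finset.prod_const, Finset.card_univ]
    rfl
  simp_rw [hI]
  have hterm : ∀ σ τ : Perm n, ((Equiv.Perm.sign σ : ℤ) : ℂ) * ((Equiv.Perm.sign τ : ℤ) : ℂ) *
      ((2 * π : ℂ) ^ Fintype.card n *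
        ∏ b, (besselI (((enum n (σ.symm b) : ℕ) : ℤ) - ((enum n (τ.symm b) : ℕ) : ℤ) + q).natAbs x : ℂ))
      = (2 * π : ℂ) ^ Fintype.card n * (((Equiv.Perm.sign σ : ℤ) : ℂ) * ((Equiv.Perm.sign τ : ℤ) : ℂ) *
        ∏ b, (besselI (((enum n (σ.symm b) : ℕ) : ℤ) - ((enum n (τ.symm b) : ℕ) : ℤ) + q).natAbs x : ℂ)) := by
    intro σ τ; ring
  simp_rw [hterm, ← Finset.mul_sum]
  have key := sum_sum_sign_mul_sign_mul_prod_eq_factorial_mul_det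
    (Matrix.of fun i j : n => (besselI (((enum n i : ℕ) : ℤ) - ((enum n j : ℕ) : ℤ) + q).natAbs x : ℂ))
  simp only [Matrix.of_apply] at key
  rw [key, mul_assoc]

/-! ### 3. The flux sectors of the `U(N)` one-plaquette law -/

/-- `det(diag(e^{iθ})) = e^{iΣ_b θ_b}`, so `det(diag e^{iθ})^q = Π_b e^{iqθ_b}`. -/
theorem det_torusPt_zpow (θ : n → ℝ) (q : ℤ) :
    ((((torusPt θ : diagonalTorus n) : Matrix.unitaryGroup n ℂ) : Matrix n n ℂ).det) ^ q
      = ∏ b, cexp ((q : ℂ) * θ b * I) := by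
  rw [coe_torusPt, Matrix.det_diagonal, ← Finset.prod_zpow]
  refine Finset.prod_congr rfl fun b _ => ?_
  rw [← Complex.exp_int_mul]
  ring_nf

/-- `det` is a class function on `U(n)`: `det(g u g⁻¹) = det u`. -/
theorem det_conj_unitaryGroup (g u : Matrix.unitaryGroup n ℂ) :
    (((g * u * g⁻¹ : Matrix.unitaryGroup n ℂ)) : Matrix n n ℂ).det = ((u : Matrix.unitaryGroup n ℂ) : Matrix n n ℂ).det := by
  have h2 : (g : Matrix n n ℂ).det * (star (g : Matrix n n ℂ)).det = 1 := by
    rw [← Matrix.det_mul, Matrix.mem_unitaryGroup_iff.mp g.2, Matrix.det_one]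
  rw [show (((g * u * g⁻¹ : Matrix.unitaryGroup n ℂ)) : Matrix n n ℂ)
      = (g : Matrix n n ℂ) * (u : Matrix n n ℂ) * star (g : Matrix n n ℂ) from rfl,
    Matrix.det_mul, Matrix.det_mul]
  calc (g : Matrix n n ℂ).det * ((u : Matrix.unitaryGroup n ℂ) : Matrix n n ℂ).det * (star (g : Matrix n n ℂ)).det
      = ((u : Matrix.unitaryGroup n ℂ) : Matrix n n ℂ).det * ((g : Matrix n n ℂ).det * (star (g : Matrix n n ℂ)).det) := by
        ring
    _ = ((u : Matrix.unitaryGroup n ℂ) : Matrix n n ℂ).det := by rw [h2, mul_one]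

/-- **THE FLUX SECTORS OF THE `U(n)` ONE-PLAQUETTE LAW**: for every finite `n` (`N = |n|`), `q ∈ ℤ`, real `x`,
`∫_{U(n)} (det U)^q e^{x Re tr U} dU = det[I_{|i−j+q|}(x)]_{i,j : Fin N}`. -/
theorem integral_haar_unitaryGroup_det_zpow_mul_exp (x : ℝ) (q : ℤ) :
    ∫ u, (((u : Matrix.unitaryGroup n ℂ) : Matrix n n ℂ).det) ^ q *
          (Real.exp (x * ((u : Matrix.unitaryGroup n ℂ) : Matrix n n ℂ).trace.re) : ℂ)
        ∂(haarProbability (Matrix.unitaryGroup n ℂ))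
      = ((Matrix.of fun i j : Fin (Fintype.card n) => besselI ((i : ℤ) - (j : ℤ) + q).natAbs x).det : ℂ) := by
  have hF : Continuous fun u : Matrix.unitaryGroup n ℂ => (((u : Matrix.unitaryGroup n ℂ) : Matrix n n ℂ).det) ^ q *
      (Real.exp (x * ((u : Matrix.unitaryGroup n ℂ) : Matrix n n ℂ).trace.re) : ℂ) := by
    refine Continuous.mul ?_ (Complex.continuous_ofReal.comp (Real.continuous_exp.comp (continuous_const.mul
      (Complex.continuous_re.comp (continuous_id.matrix_trace.comp continuous_subtype_val)))))
    have hdet : Continuous fun u : Matrix.unitaryGroup n ℂ => ((u : Matrix.unitaryGroup n ℂ) : Matrix n n ℂ).det :=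
      (continuous_id.matrix_det).comp continuous_subtype_val
    refine hdet.zpow₀ q fun u => Or.inl ?_
    exact fun h => by simpa [h] using norm_det_eq_one u.2
  have hcl : ∀ g u : Matrix.unitaryGroup n ℂ,
      (((g * u * g⁻¹ : Matrix.unitaryGroup n ℂ) : Matrix n n ℂ).det) ^ q *
          (Real.exp (x * (((g * u * g⁻¹ : Matrix.unitaryGroup n ℂ)) : Matrix n n ℂ).trace.re) : ℂ)
        = (((u : Matrix.unitaryGroup n ℂ) : Matrix n n ℂ).det) ^ q *
          (Real.exp (x * ((u : Matrix.unitaryGroup n ℂ) : Matrix n n ℂ).trace.re) : ℂ) := by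
    intro g u
    rw [det_conj_unitaryGroup, trace_conj_unitaryGroup]
  rw [integral_haar_unitaryGroup_classFun_complex hF hcl]
  simp_rw [det_torusPt_zpow, trace_re_torusPt, prod_OD_norm_sub_sq_eq_norm_vdm_sq]
  have hfun : ∀ θ : n → ℝ, (∏ b, cexp ((q : ℂ) * θ b * I)) * ((Real.exp (x * ∑ b, Real.cos (θ b)) : ℝ) : ℂ) *
      ((‖vdm θ‖ ^ 2 : ℝ) : ℂ)
      = (∏ b, (cexp ((x : ℂ) * Real.cos (θ b)) * cexp ((q : ℂ) * θ b * I))) * ((‖vdm θ‖ ^ 2 : ℝ) : ℂ) := by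
    intro θ
    rw [Finset.mul_sum, Real.exp_sum, Complex.ofReal_prod, ← Finset.prod_mul_distrib]
    congr 1
    refine Finset.prod_congr rfl fun b _ => ?_
    rw [mul_comm, Complex.ofReal_exp]
    push_cast
    ring_nf
  simp_rw [hfun]
  rw [integral_cube_prod_cexp_cos_twist_mul_norm_vdm_sq,
    show (Matrix.of fun i j : n => (besselI (((enum n i : ℕ) : ℤ) - ((enum n j : ℕ) : ℤ) + q).natAbs x : ℂ))
      = (Matrix.of fun i j : Fin (Fintype.card n) => (besselI ((i : ℤ) - (j : ℤ) + q).natAbs x : ℂ)).submatrix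
          (enum n) (enum n) from by ext i j; rfl, Matrix.det_submatrix_equiv_self]
  have hdet : ((Matrix.of fun i j : Fin (Fintype.card n) => besselI ((i : ℤ) - (j : ℤ) + q).natAbs x).det : ℂ)
      = (Matrix.of fun i j : Fin (Fintype.card n) => (besselI ((i : ℤ) - (j : ℤ) + q).natAbs x : ℂ)).det := by
    rw [← Complex.ofRealHom_eq_coe, RingHom.map_det]
    congr 1
  rw [← hdet, ← mul_assoc,
    show ((2 * π : ℂ)) ^ Fintype.card n * ((Fintype.card n).factorial : ℂ)
      = (((2 * π) ^ Fintype.card n * (Fintype.card n).factorial : ℝ) : ℂ) by push_cast; ring,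
    ← Complex.ofReal_mul,
    inv_mul_cancel₀ (by positivity : (0 : ℝ) < (2 * π) ^ Fintype.card n * (Fintype.card n).factorial).ne',
    Complex.ofReal_one, one_mul]

/-- **`U(N)` literally**: `∫_{U(N)} (det U)^q e^{x Re tr U} dU = det[I_{|i−j+q|}(x)]_{i,j<N}`. -/
theorem integral_haar_unitaryGroup_fin_det_zpow_mul_exp (N : ℕ) (x : ℝ) (q : ℤ) :
    ∫ u, (((u : Matrix.unitaryGroup (Fin N) ℂ) : Matrix (Fin N) (Fin N) ℂ).det) ^ q *
          (Real.exp (x * ((u : Matrix.unitaryGroup (Fin N) ℂ) : Matrix (Fin N) (Fin N) ℂ).trace.re) : ℂ)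
        ∂(haarProbability (Matrix.unitaryGroup (Fin N) ℂ))
      = ((Matrix.of fun i j : Fin N => besselI ((i : ℤ) - (j : ℤ) + q).natAbs x).det : ℂ) := by
  rw [integral_haar_unitaryGroup_det_zpow_mul_exp]
  congr 1
  rw [show (Matrix.of fun i j : Fin (Fintype.card (Fin N)) => besselI ((i : ℤ) - (j : ℤ) + q).natAbs x)
      = (Matrix.of fun i j : Fin N => besselI ((i : ℤ) - (j : ℤ) + q).natAbs x).submatrix
          (finCongr (Fintype.card_fin N)) (finCongr (Fintype.card_fin N)) from by ext i j; simp,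
    Matrix.det_submatrix_equiv_self]

/-- **The expectation of `det U_p` under the `U(N)` one-plaquette law** (the `U(1)` part of the plaquette):
`⟨det U⟩_x = det[I_{|i−j+1|}(x)] / det[I_{|i−j|}(x)]` — in particular it is real. -/
theorem unitary_onePlaquette_det_expect (N : ℕ) (x : ℝ) :
    (∫ u, ((u : Matrix.unitaryGroup (Fin N) ℂ) : Matrix (Fin N) (Fin N) ℂ).det *
          (Real.exp (x * ((u : Matrix.unitaryGroup (Fin N) ℂ) : Matrix (Fin N) (Fin N) ℂ).trace.re) : ℂ)
        ∂(haarProbability (Matrix.unitaryGroup (Fin N) ℂ)))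
      / (∫ u, Real.exp (x * ((u : Matrix.unitaryGroup (Fin N) ℂ) : Matrix (Fin N) (Fin N) ℂ).trace.re)
        ∂(haarProbability (Matrix.unitaryGroup (Fin N) ℂ)) : ℝ)
      = (((Matrix.of fun i j : Fin N => besselI ((i : ℤ) - (j : ℤ) + 1).natAbs x).det /
          (Matrix.of fun i j : Fin N => besselI ((i : ℤ) - (j : ℤ)).natAbs x).det : ℝ) : ℂ) := by
  have h := integral_haar_unitaryGroup_fin_det_zpow_mul_exp N x 1
  simp only [zpow_one] at h
  rw [h, integral_haar_unitaryGroup_fin_exp_mul_trace_re]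
  norm_cast

end Summit.Ventures.LatticeQCDFlow.Scoring
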